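import Literature.Topology.FourManifolds.FlowSaturatedFunctions
import Literature.Topology.FourManifolds.TubeFlowGeometryForward
import Literature.Topology.FourManifolds.HandleModelField
import HarnessLib

/-!
# The system of `2`-handle boxes of the Morse-theoretic trisection: coordinates, the switch
# sets, and the hitting dichotomy in the band

Topic `Literature/Topology/FourManifolds`; step E3c (part i) of a Morse-theoretic construction of
Gay–Kirby's trisection for the fact seat
`provefact-Literature.Topology.FourManifolds.exists_isBalancedGKTrisection` (Gay–Kirby 2016,
Thm. 4 via §4, Lemma 14).  Everything in this file is **proved**; the definitions are explicit.

`HandleBoxes f ξ a η ι`: index-`2` Milnor boxes `D j` of `(f, ξ)` (Milnor 1965, Def. 3.1) about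
the critical points `c j` of the level `a + η`, with disjoint chart domains, `3η < ε_j²`, the
level `a` regular, and no other critical value in `[a - η, a + 2η)`.  In these terms:

* the coordinates `A_j, B_j, P_j = A_j B_j` are smooth on the chart domains
  (`contMDiffAt_sqSumLT`, …, from `contDiff_sqSumLT` of `HandleModelField.lean`);
* the **switch sets** `S_j = {z ∈ source_j | P_j z < P_sw}` are open and, inside the band
  `a - η < f < a + 2η`, contained in the closed boxes (`swSet_inter_band_subset_closedBox`,
  for `P_sw ≤ η²`) — so a band point outside `source_j` has a neighbourhood missing `S_j`;
* **hitting dichotomy**: a point of the band either hits the level `a` or lies in some box with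
  `A_j = 0`, hence in `S_j` (`hits_or_exists_mem_swSet`);
* **near the switch boundary the lifted Heegaard function is small**: if `φ ≤ v₁` on the part
  `P_j < 2P_sw` of the level in `source_j`, then every hitting point `w ∈ source_j` of the band
  with `P_j w < 2 P_sw` has `φ̄ w ≤ v₁` (`flowLift_le_of_P_lt`; the projection is read in the box
  by `TubeFlowGeometry(Forward)`).

## References

* J. Milnor, *Lectures on the h-cobordism theorem* (1965), Def. 3.1, proof of Thm. 3.12,
  Thm. 4.1. [MilnorHCobordism1965]
* D. Gay, R. Kirby, *Trisecting 4-manifolds*, Geom. Topol. 20 (2016), §4, Lemma 14. [GayKirby2016]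
-/

open scoped Manifold ContDiff Topology
open Set Function Filter Metric

noncomputable section

universe u

namespace Literature.Topology.FourManifolds

open Flow

/-- Local notation: `𝔼 n` is the model Euclidean space `EuclideanSpace ℝ (Fin n)`. -/
local notation "𝔼 " n:arg => EuclideanSpace ℝ (Fin n)

/-! ### Smoothness of the box coordinates -/

variable {X : Type u} [TopologicalSpace X] [ChartedSpace (𝔼 4) X]
  {f : X → ℝ} {ξ : Π x : X, TangentSpace (𝓡 4) x} {c : X}

/-- The centred coordinates of a Milnor box are smooth on the chart domain. [cite: MilnorHCobordism1965, Def. 3.1] -/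
theorem MilnorBox.contMDiffAt_coord [IsManifold (𝓡 4) ∞ X] (D : MilnorBox (𝓡 4) f ξ c) {z : X}
    (hz : z ∈ D.chart.source) : ContMDiffAt (𝓡 4) 𝓘(ℝ, 𝔼 4) ∞ D.coord z :=
  (D.chart.contMDiffAt_extend D.mem_maximalAtlas hz).sub contMDiffAt_const

/-- `A` is smooth on the chart domain. [folklore] -/
theorem MilnorBox.contMDiffAt_sqSumLT [IsManifold (𝓡 4) ∞ X] (D : MilnorBox (𝓡 4) f ξ c) {z : X}
    (hz : z ∈ D.chart.source) :
    ContMDiffAt (𝓡 4) 𝓘(ℝ, ℝ) ∞ (fun w => sqSumLT D.k (D.coord w)) z :=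
  ((contDiff_sqSumLT D.k).contMDiff.contMDiffAt).comp z (D.contMDiffAt_coord hz)

/-- `B` is smooth on the chart domain. [folklore] -/
theorem MilnorBox.contMDiffAt_sqSumGE [IsManifold (𝓡 4) ∞ X] (D : MilnorBox (𝓡 4) f ξ c) {z : X}
    (hz : z ∈ D.chart.source) :
    ContMDiffAt (𝓡 4) 𝓘(ℝ, ℝ) ∞ (fun w => sqSumGE D.k (D.coord w)) z :=
  ((contDiff_sqSumGE D.k).contMDiff.contMDiffAt).comp z (D.contMDiffAt_coord hz)

/-! ### The system of boxes -/

/-- **The `2`-handle boxes of the trisection**: index-`2` Milnor boxes of `(f, ξ)` about the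
critical points `cpt j` of the level `a + η`, pairwise disjoint chart domains, size `3η < ε_j²`,
the level `a` regular, and no critical value in `[a - η, a + 2η)` other than `a + η` at the
`cpt j`. [cite: MilnorHCobordism1965, Def. 3.1] [cite: GayKirby2016, §4, Lemma 14] -/
structure HandleBoxes (f : X → ℝ) (ξ : Π x : X, TangentSpace (𝓡 4) x) (a η : ℝ) (ι : Type) where
  /-- The index-`2` critical points. -/
  cpt : ι → X
  /-- The Milnor boxes. -/
  box : ∀ j, MilnorBox (𝓡 4) f ξ (cpt j)
  /-- The boxes have index `2`. -/
  k_eq : ∀ j, (box j).k = 2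
  /-- The critical points lie on the level `a + η`. -/
  apply_cpt : ∀ j, f (cpt j) = a + η
  /-- The chart domains are pairwise disjoint. -/
  disjoint : Pairwise fun i j => Disjoint (box i).chart.source (box j).chart.source
  /-- `η > 0`. -/
  eta_pos : 0 < η
  /-- The boxes are large compared to `η`. -/
  eta_lt : ∀ j, 3 * η < (box j).ε ^ 2
  /-- The only critical points with value in `[a - η, a + 2η)` are the `cpt j`. -/
  crit_val : ∀ q, IsMCriticalPt (𝓡 4) f q → a - η ≤ f q → f q < a + 2 * η → ∃ j, q = cpt j

namespace HandleBoxes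

variable {a η : ℝ} {ι : Type} (H : HandleBoxes f ξ a η ι)

/-- `A_j(z) = |x⃗_j|²`. [cite: MilnorHCobordism1965, Def. 3.1] -/
def A (j : ι) (z : X) : ℝ := sqSumLT (H.box j).k ((H.box j).coord z)

/-- `B_j(z) = |y⃗_j|²`. [cite: MilnorHCobordism1965, Def. 3.1] -/
def B (j : ι) (z : X) : ℝ := sqSumGE (H.box j).k ((H.box j).coord z)

/-- `P_j = A_j B_j`, the first integral of the model flow. [cite: MilnorHCobordism1965, proof of Thm. 3.12] -/
def P (j : ι) (z : X) : ℝ := H.A j z * H.B j z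

/-- Unfolding. [folklore] -/
theorem A_def (j : ι) (z : X) : H.A j z = sqSumLT (H.box j).k ((H.box j).coord z) := rfl
/-- Unfolding. [folklore] -/
theorem B_def (j : ι) (z : X) : H.B j z = sqSumGE (H.box j).k ((H.box j).coord z) := rfl
/-- Unfolding. [folklore] -/
theorem P_def (j : ι) (z : X) : H.P j z = H.A j z * H.B j z := rfl

/-- `A ≥ 0`. [folklore] -/
theorem A_nonneg (j : ι) (z : X) : 0 ≤ H.A j z := sqSumLT_nonneg _ _
/-- `B ≥ 0`. [folklore] -/
theorem B_nonneg (j : ι) (z : X) : 0 ≤ H.B j z := sqSumGE_nonneg _ _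
/-- `P ≥ 0`. [folklore] -/
theorem P_nonneg (j : ι) (z : X) : 0 ≤ H.P j z := mul_nonneg (H.A_nonneg j z) (H.B_nonneg j z)

/-- `f = a + η - A_j + B_j` on the chart domain. [cite: MilnorHCobordism1965, Def. 3.1] -/
theorem apply_eq {j : ι} {z : X} (hz : z ∈ (H.box j).chart.source) :
    f z = a + η - H.A j z + H.B j z := by
  rw [(H.box j).apply_eq_sub_add hz, H.apply_cpt j]; rfl

/-- The level `a` is `f (cpt j) - η`. [folklore] -/
theorem level_eq (j : ι) : f (H.cpt j) - η = a := by rw [H.apply_cpt j]; ring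

include H in
/-- The level `a` carries no critical point. [folklore] -/
theorem not_isMCriticalPt_of_apply_eq {x : X} (hx : f x = a) : ¬ IsMCriticalPt (𝓡 4) f x := by
  intro hc
  obtain ⟨j, rfl⟩ := H.crit_val x hc (by rw [hx]; linarith [H.eta_pos]) (by rw [hx]; linarith [H.eta_pos])
  have := H.apply_cpt j
  rw [hx] at this
  linarith [H.eta_pos]

/-- The regularity hypothesis in the form the flow lemmas ask for. [folklore] -/
theorem forall_not_isMCriticalPt (j : ι) : ∀ x, f x = f (H.cpt j) - η → ¬ IsMCriticalPt (𝓡 4) f x := by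
  intro x hx
  rw [H.level_eq j] at hx
  exact H.not_isMCriticalPt_of_apply_eq hx

/-- `A_j` is continuous on the chart domain. [folklore] -/
theorem continuousOn_A (j : ι) : ContinuousOn (H.A j) (H.box j).chart.source :=
  (H.box j).continuousOn_sqSum_coord.1
/-- `B_j` is continuous on the chart domain. [folklore] -/
theorem continuousOn_B (j : ι) : ContinuousOn (H.B j) (H.box j).chart.source :=
  (H.box j).continuousOn_sqSum_coord.2
/-- `P_j` is continuous on the chart domain. [folklore] -/
theorem continuousOn_P (j : ι) : ContinuousOn (H.P j) (H.box j).chart.source :=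
  (H.continuousOn_A j).mul (H.continuousOn_B j)

/-! ### The switch sets -/

/-- **The switch set** `S_j = {z ∈ source_j | P_j z < P_sw}` (the saturated thin tube about the
`j`-th attaching circle together with the unstable disc, on which the top height is read from
`P_j`). [cite: GayKirby2016, §4, Lemma 14] -/
def swSet (Psw : ℝ) (j : ι) : Set X := {z | z ∈ (H.box j).chart.source ∧ H.P j z < Psw}

/-- Membership in the switch set. [folklore] -/
theorem mem_swSet {Psw : ℝ} {j : ι} {z : X} : z ∈ H.swSet Psw j ↔ z ∈ (H.box j).chart.source ∧ H.P j z < Psw :=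
  Iff.rfl

/-- The switch sets are open. [folklore] -/
theorem isOpen_swSet (Psw : ℝ) (j : ι) : IsOpen (H.swSet Psw j) :=
  (H.continuousOn_P j).isOpen_inter_preimage (H.box j).chart.open_source isOpen_Iio

/-- The switch sets are pairwise disjoint. [folklore] -/
theorem swSet_disjoint (Psw : ℝ) {i j : ι} (hij : i ≠ j) : Disjoint (H.swSet Psw i) (H.swSet Psw j) :=
  (H.disjoint hij).mono (fun _ hz => hz.1) (fun _ hz => hz.1)

/-- **Inside the band, the switch set lies in the closed box** (`P_sw ≤ η²`, `3η < ε²`): a point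
of `source_j` with `a - η < f < a + 2η` and `P_j < P_sw` has `A_j ≤ ε²` and `B_j ≤ 4ε²` (indeed
`A_j < 3η`, `B_j < 2η`). [cite: MilnorHCobordism1965, proof of Thm. 3.12] -/
theorem swSet_inter_band_subset {Psw : ℝ} (hPsw : Psw ≤ η ^ 2) {j : ι} {z : X}
    (hz : z ∈ H.swSet Psw j) (hf₁ : a - η < f z) (hf₂ : f z < a + 2 * η) :
    H.A j z < 3 * η ∧ H.B j z < 2 * η := by
  have hη := H.eta_pos
  have hε := H.eta_lt j
  have hfz := H.apply_eq hz.1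
  have hP : H.A j z * H.B j z < Psw := hz.2
  have hA0 := H.A_nonneg j z
  have hB0 := H.B_nonneg j z
  -- if `A ≥ 3η` then `B < η²/(3η) < η`, contradicting `A = η - s + B < 2η + B`
  have hA : H.A j z < 3 * η := by
    by_contra hA
    push Not at hA
    have hB : H.B j z * (3 * η) ≤ H.A j z * H.B j z := by nlinarith
    have hB' : H.B j z * (3 * η) < η ^ 2 := by linarith
    have hB'' : H.B j z < η := by nlinarith
    linarith
  refine ⟨hA, ?_⟩
  nlinarith

/-- Hence band points of the switch set lie in the closed box (and in the open box). [folklore] -/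
theorem mem_box_of_mem_swSet {Psw : ℝ} (hPsw : Psw ≤ η ^ 2) {j : ι} {z : X}
    (hz : z ∈ H.swSet Psw j) (hf₁ : a - η < f z) (hf₂ : f z < a + 2 * η) : z ∈ (H.box j).box := by
  obtain ⟨hA, hB⟩ := H.swSet_inter_band_subset hPsw hz hf₁ hf₂
  have hε := H.eta_lt j
  exact ⟨hz.1, by unfold HandleBoxes.A at hA; linarith, by unfold HandleBoxes.B at hB; nlinarith [H.eta_pos]⟩

/-- **A band point outside `source_j` has a neighbourhood missing the switch set `S_j`** (the
band part of `S_j` lies in the compact closed box inside `source_j`). [folklore] -/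
theorem eventually_not_mem_swSet_of_not_mem_source [T2Space X] {Psw : ℝ} (hPsw : Psw ≤ η ^ 2)
    (hf : Continuous f) {j : ι} {z : X} (hz : z ∉ (H.box j).chart.source)
    (hf₁ : a - η < f z) (hf₂ : f z < a + 2 * η) : ∀ᶠ w in 𝓝 z, w ∉ H.swSet Psw j := by
  set K : Set X := {q' | q' ∈ (H.box j).chart.source ∧ sqSumLT (H.box j).k ((H.box j).coord q') ≤ (H.box j).ε ^ 2 ∧
      sqSumGE (H.box j).k ((H.box j).coord q') ≤ 4 * (H.box j).ε ^ 2} with hK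
  have hKc : IsClosed K := (H.box j).isClosed_closedBox
  have hzK : z ∉ K := fun h => hz h.1
  have hband : ∀ᶠ w in 𝓝 z, a - η < f w ∧ f w < a + 2 * η :=
    (hf.continuousAt.eventually (Ioo_mem_nhds hf₁ hf₂)).mono fun w hw => hw
  filter_upwards [hKc.isOpen_compl.mem_nhds hzK, hband] with w hwK hw hwS
  exact hwK ((H.box j).box_subset_closedBox (H.mem_box_of_mem_swSet hPsw hwS hw.1 hw.2))

/-! ### Smoothness of the coordinates; the hitting dichotomy in the band -/

variable [IsManifold (𝓡 4) ∞ X]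

/-- `A_j` is smooth on the chart domain. [folklore] -/
theorem contMDiffAt_A {j : ι} {z : X} (hz : z ∈ (H.box j).chart.source) :
    ContMDiffAt (𝓡 4) 𝓘(ℝ, ℝ) ∞ (H.A j) z := (H.box j).contMDiffAt_sqSumLT hz
/-- `B_j` is smooth on the chart domain. [folklore] -/
theorem contMDiffAt_B {j : ι} {z : X} (hz : z ∈ (H.box j).chart.source) :
    ContMDiffAt (𝓡 4) 𝓘(ℝ, ℝ) ∞ (H.B j) z := (H.box j).contMDiffAt_sqSumGE hz
/-- `P_j` is smooth on the chart domain. [folklore] -/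
theorem contMDiffAt_P {j : ι} {z : X} (hz : z ∈ (H.box j).chart.source) :
    ContMDiffAt (𝓡 4) 𝓘(ℝ, ℝ) ∞ (H.P j) z := (H.contMDiffAt_A hz).mul (H.contMDiffAt_B hz)

variable [T2Space X] [CompactSpace X]
  {hξ : ContMDiff (𝓡 4) (𝓡 4).tangent ∞ fun x => (⟨x, ξ x⟩ : TangentBundle (𝓡 4) X)}

/-- **Hitting dichotomy.**  A point of the band `a - η < f z < a + 2η` either hits the level `a`,
or lies in one of the boxes with `A_j = 0` (so in every switch set `S_j` with `P_sw > 0`).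
[cite: MilnorHCobordism1965, Thm. 3.4, proof of Thm. 3.12] -/
theorem hits_or_exists_A_eq_zero (hgl : IsGradientLike (𝓡 4) f ξ) (hfM : IsMorse (𝓡 4) f)
    {z : X} (hf₁ : a - η < f z) (hf₂ : f z < a + 2 * η) :
    Hits (flowθ hξ) f a z ∨ ∃ j, z ∈ (H.box j).box ∧ H.A j z = 0 := by
  by_cases hh : Hits (flowθ hξ) f a z
  · exact Or.inl hh
  right
  have hη := H.eta_pos
  rcases le_or_gt (f z) a with hle | hgt
  · -- below the level every point hits (no critical value in `(f z, a]`)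
    exfalso
    refine hh (hgl.hits_of_forall_not_mem_Ioc hfM hξ (fun hc => ?_) hle fun q hq hq' => ?_)
    · obtain ⟨j, rfl⟩ := H.crit_val z hc hf₁.le hf₂
      have := H.apply_cpt j; linarith
    · obtain ⟨j, rfl⟩ := H.crit_val q hq (by linarith [hq'.1]) (by linarith [hq'.2])
      have := H.apply_cpt j; linarith [hq'.2]
  · have hcrit : ∀ q, IsMCriticalPt (𝓡 4) f q → (a + η) - η ≤ f q → f q < (a + η) + η → ∃ j, q = H.cpt j :=
      fun q hq h₁ h₂ => H.crit_val q hq (by linarith) (by linarith)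
    have hB₁ : ∀ j, η ≤ 4 * (H.box j).ε ^ 2 := fun j => by linarith [H.eta_lt j]
    have hnot : ¬ Hits (flowθ hξ) f ((a + η) - η) z := by rwa [show (a + η) - η = a by ring]
    obtain ⟨j, hbox, hA⟩ := exists_mem_box_sqSumLT_eq_zero_of_not_hits H.box hgl hfM H.apply_cpt hcrit hB₁
      (by linarith) (by linarith) hnot
    exact ⟨j, hbox, hA⟩

/-- A non-hitting band point lies in the switch sets of its box. [folklore] -/
theorem exists_mem_swSet_of_not_hits (hgl : IsGradientLike (𝓡 4) f ξ) (hfM : IsMorse (𝓡 4) f)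
    {Psw : ℝ} (hPsw : 0 < Psw) {z : X} (hf₁ : a - η < f z) (hf₂ : f z < a + 2 * η)
    (hh : ¬ Hits (flowθ hξ) f a z) : ∃ j, z ∈ H.swSet Psw j ∧ H.A j z = 0 := by
  rcases H.hits_or_exists_A_eq_zero (hξ := hξ) hgl hfM hf₁ hf₂ with h | ⟨j, hbox, hA⟩
  · exact absurd h hh
  · exact ⟨j, ⟨hbox.1, by rw [P_def, hA, zero_mul]; exact hPsw⟩, hA⟩

/-- A hitting point of a box has `A_j > 0`. [folklore] -/
theorem A_pos_of_hits (hgl : IsGradientLike (𝓡 4) f ξ) (hfM : IsMorse (𝓡 4) f) {j : ι} {z : X}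
    (hz : z ∈ (H.box j).box) (hh : Hits (flowθ hξ) f a z) : 0 < H.A j z := by
  rcases (H.A_nonneg j z).eq_or_lt with h0 | h0
  · exfalso
    have := (H.box j).not_hits_of_sqSumLT_eq_zero (hξ := hξ) hgl hfM H.eta_pos hz h0.symm
    rw [H.level_eq j] at this
    exact this hh
  · exact h0

/-- **The level projection of a band point of `source_j` with small `P_j`, read in the box**:
`π z ∈ source_j` and `P_j (π z) = P_j z` (and the tube function is conserved), whether `z` is
above the level (backwards, `TubeFlowGeometry`) or below it (forwards, `TubeFlowGeometryForward`).
[cite: MilnorHCobordism1965, proof of Thm. 3.12; Thm. 4.1] [cite: GayKirby2016, §4, Lemma 14] -/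
theorem exists_levelProj_mem (hgl : IsGradientLike (𝓡 4) f ξ) (hfM : IsMorse (𝓡 4) f)
    {Psw : ℝ} (hPsw : 2 * Psw ≤ η ^ 2) {j : ι} {z : X} (hzsrc : z ∈ (H.box j).chart.source)
    (hP : H.P j z < 2 * Psw) (hf₁ : a - η < f z) (hf₂ : f z < a + 2 * η) (hh : Hits (flowθ hξ) f a z) :
    levelProj hξ f a z ∈ (H.box j).chart.source ∧ H.P j (levelProj hξ f a z) = H.P j z ∧
      ∀ ε' κ η' : ℝ, TubeModel.tube ε' κ η' ((H.box j).coord (levelProj hξ f a z)) =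
        TubeModel.tube ε' κ η' ((H.box j).coord z) := by
  have hη := H.eta_pos
  have hε := H.eta_lt j
  have hz2 : z ∈ H.swSet (2 * Psw) j := ⟨hzsrc, hP⟩
  have hPsw' : 2 * Psw ≤ η ^ 2 := hPsw
  obtain ⟨hA3, hB2⟩ := H.swSet_inter_band_subset hPsw' hz2 hf₁ hf₂
  have hbox : z ∈ (H.box j).box := H.mem_box_of_mem_swSet hPsw' hz2 hf₁ hf₂
  have hApos : 0 < H.A j z := H.A_pos_of_hits hgl hfM hbox hh
  have hreg := H.forall_not_isMCriticalPt j
  rcases le_or_gt a (f z) with hge | hlt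
  · -- above the level: backwards
    have hfz : f (H.cpt j) - η ≤ f z := by rw [H.level_eq j]; exact hge
    have hsmall : η + 2 * η < (H.box j).ε ^ 2 := by linarith
    obtain ⟨t, ht, -, hproj, hseg, hPt, htube, -⟩ :=
      (H.box j).exists_levelProj_eq_flow (hξ := hξ) (H.k_eq j) hgl hfM hη hsmall hreg hzsrc hApos hfz hB2.le
    rw [H.level_eq j] at hproj
    rw [hproj]
    exact ⟨(hseg t ⟨le_rfl, ht⟩).1, hPt, htube⟩
  · -- below the level: forwards
    have hfz : f z ≤ f (H.cpt j) - η := by rw [H.level_eq j]; exact hlt.le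
    have hAmax : 3 * η < (H.box j).ε ^ 2 := hε
    have hPP : H.A j z * H.B j z < 4 * η * (H.box j).ε ^ 2 := by
      have : H.A j z * H.B j z < 2 * Psw := hP
      nlinarith
    obtain ⟨t, ht, -, hproj, hseg, hPt, htube, -⟩ :=
      (H.box j).exists_levelProj_eq_flow_of_le (hξ := hξ) (H.k_eq j) hgl hfM hη hAmax hreg hzsrc hA3.le hfz hPP
    rw [H.level_eq j] at hproj
    rw [hproj]
    exact ⟨(hseg t ⟨ht, le_rfl⟩).1, hPt, htube⟩

/-- **Near the switch boundary the lifted Heegaard function is small.**  If `φ ≤ v₁` on the part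
`{P_j < 2P_sw}` of the level inside `source_j`, then a hitting band point `w ∈ source_j` with
`P_j w < 2P_sw` has `φ̄ w ≤ v₁`. [cite: GayKirby2016, §4, Lemma 14] -/
theorem flowLift_le_of_P_lt (hgl : IsGradientLike (𝓡 4) f ξ) (hfM : IsMorse (𝓡 4) f)
    {h : IsRegularLevel (𝓡 4) f a} {φ : RegularLevel h → ℝ} {Psw v₁ : ℝ} (hPsw : 2 * Psw ≤ η ^ 2) {j : ι}
    (hφ : ∀ y : RegularLevel h, y.1 ∈ (H.box j).chart.source → H.P j y.1 < 2 * Psw → φ y ≤ v₁)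
    {w : X} (hwsrc : w ∈ (H.box j).chart.source) (hP : H.P j w < 2 * Psw)
    (hf₁ : a - η < f w) (hf₂ : f w < a + 2 * η) (hh : Hits (flowθ hξ) f a w) :
    flowLift hξ h φ w ≤ v₁ := by
  obtain ⟨hsrc, hPeq, -⟩ := H.exists_levelProj_mem hgl hfM hPsw hwsrc hP hf₁ hf₂ hh
  rw [flowLift_of_hits φ hh]
  exact hφ _ hsrc (by rw [hPeq]; exact hP)

end HandleBoxes

end Literature.Topology.FourManifolds

end
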